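import Mathlib
import Literature.MathematicalPhysics.MHD.GradShafranov
import HarnessLib

/-!
# The Cerfon–Freidberg exact solutions of the Grad–Shafranov equation with Solov'ev profiles (as printed, proved)

Typed AS PRINTED from J. P. Freidberg, *Ideal MHD* (CUP 2014) §6.6.1 and §6.6.5 — bib key `Freidberg2014`,
which states that the construction «follows the analysis presented in Cerfon and Freidberg (2010)» (Phys.
Plasmas 17, 032502; paywalled, acquisition requested by the LADDER-GRIDFUSION cell 2026-08-26):

* the normalised Solov'ev equation `X ∂_X(X⁻¹ ∂_X U) + ∂_Y² U = α + (1 − α)X²` (6.150) is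
  `GradShafranov.IsNormalisedSolovevSolutionOn`;
* particular solution `U_P = (α/2) X² ln X + ((1−α)/8) X⁴` (6.151);
* the seven up–down symmetric polynomial(-logarithmic) homogeneous solutions `U₀ … U₆` (6.153) and the
  five odd ones `U₇ … U₁₁` (6.161); the full solutions `U = U_P + Σ c_j U_j` (6.153)/(6.160);
* the seven boundary constraints (6.155) with the curvature coefficients `N₁, N₂, N₃` (6.156) on the
  reference surface `X = 1 + ε cos(τ + δ₀ sin τ)`, `Y = εκ sin τ` (6.154), and the five X-point /
  slope constraints (6.162);
* the figures of merit `q_*, β_p, β_t` in terms of the area integrals `K₁, K₂, K₃` (6.157)–(6.158).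

PROVED here (finite calculus identities, `X > 0`): `Δ* U_P = α + (1−α)X²`, `Δ* U_j = 0` for all twelve
`j`, hence every `U_P + Σ c_j U_j` solves (6.150) on `{X > 0}` — i.e. the printed family IS a family of
exact solutions (the book: «The exact form of each polynomial solution can be easily found by direct
substitution»). Locators read on the page by the typer (gridfusion-model-5, 2026-08-26; galaxy
panama:388488381857833 c437000–498000): §6.6.1 pp.177–181, §6.6.5 pp.189–191.
Design: curried `U : ℝ → ℝ → ℝ` of `(X, Y)`, `Real.log` (total; theorems assume `0 < X`); the sums
over `j` are written out term by term so that `ring` sees them; private calculus helpers handle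
`P(X) + Q(X) ln X` with even sextics `P, Q`. HONEST FRAMING: model objects only (ideal MHD, Solov'ev
profiles); nothing here is about a device; the reference surface (6.154) is matched at finitely many
points only — the plasma boundary of a solution is its own level set `U = 0`.
-/

noncomputable section

namespace Literature.MathematicalPhysics.MHD.CerfonFreidberg

open GradShafranov _root_.Real

/-! ## Private calculus helpers: `f(x) = P(x) + Q(x) log x`, `P, Q` even sextics -/

/-- Derivative of `p₀ + p₂x² + p₄x⁴ + p₆x⁶`. [folklore] -/
private theorem hasDerivAt_even (p₀ p₂ p₄ p₆ x : ℝ) :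
    HasDerivAt (fun x => p₀ + p₂ * x ^ 2 + p₄ * x ^ 4 + p₆ * x ^ 6)
      (2 * p₂ * x + 4 * p₄ * x ^ 3 + 6 * p₆ * x ^ 5) x := by
  have h := (((hasDerivAt_const x p₀).fun_add ((hasDerivAt_pow 2 x).const_mul p₂)).fun_add
    ((hasDerivAt_pow 4 x).const_mul p₄)).fun_add ((hasDerivAt_pow 6 x).const_mul p₆)
  exact h.congr_deriv (by norm_num; ring)

/-- Derivative of a general sextic `g₀ + g₁y + … + g₆y⁶`. [folklore] -/
private theorem hasDerivAt_sextic (g₀ g₁ g₂ g₃ g₄ g₅ g₆ y : ℝ) :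
    HasDerivAt (fun y => g₀ + g₁ * y + g₂ * y ^ 2 + g₃ * y ^ 3 + g₄ * y ^ 4 + g₅ * y ^ 5 + g₆ * y ^ 6)
      (g₁ + 2 * g₂ * y + 3 * g₃ * y ^ 2 + 4 * g₄ * y ^ 3 + 5 * g₅ * y ^ 4 + 6 * g₆ * y ^ 5) y := by
  have h := ((((((hasDerivAt_const y g₀).fun_add ((hasDerivAt_id' y).const_mul g₁)).fun_add
    ((hasDerivAt_pow 2 y).const_mul g₂)).fun_add ((hasDerivAt_pow 3 y).const_mul g₃)).fun_add
    ((hasDerivAt_pow 4 y).const_mul g₄)).fun_add ((hasDerivAt_pow 5 y).const_mul g₅)).fun_add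
    ((hasDerivAt_pow 6 y).const_mul g₆)
  exact h.congr_deriv (by norm_num; ring)

/-- Derivative of `P(x) + Q(x) log x` at `x > 0` for even sextics `P` and `Q = q₀ + q₂x² + q₄x⁴ + q₆x⁶`:
`P′ + Q′ log x + Q x⁻¹`. [folklore] -/
private theorem hasDerivAt_PQlog (p₀ p₂ p₄ p₆ q₀ q₂ q₄ q₆ : ℝ) {x : ℝ} (hx : 0 < x) :
    HasDerivAt (fun x => p₀ + p₂ * x ^ 2 + p₄ * x ^ 4 + p₆ * x ^ 6
        + (q₀ + q₂ * x ^ 2 + q₄ * x ^ 4 + q₆ * x ^ 6) * Real.log x)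
      (2 * p₂ * x + 4 * p₄ * x ^ 3 + 6 * p₆ * x ^ 5
        + (2 * q₂ * x + 4 * q₄ * x ^ 3 + 6 * q₆ * x ^ 5) * Real.log x
        + (q₀ + q₂ * x ^ 2 + q₄ * x ^ 4 + q₆ * x ^ 6) * x⁻¹) x :=
  ((hasDerivAt_even p₀ p₂ p₄ p₆ x).fun_add
    ((hasDerivAt_even q₀ q₂ q₄ q₆ x).fun_mul (Real.hasDerivAt_log hx.ne'))).congr_deriv (by ring)

/-- `∂U/∂X` when `x ↦ U(x, Y)` has the form `P(x) + Q(x) log x` with `Q(0) = 0` (all `x`), at `X > 0`.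
[folklore] -/
private theorem dR_PQlog {U : ℝ → ℝ → ℝ} {Y p₀ p₂ p₄ p₆ q₂ q₄ q₆ : ℝ}
    (hU : ∀ x, U x Y = p₀ + p₂ * x ^ 2 + p₄ * x ^ 4 + p₆ * x ^ 6
        + (0 + q₂ * x ^ 2 + q₄ * x ^ 4 + q₆ * x ^ 6) * Real.log x) {X : ℝ} (hX : 0 < X) :
    dR U X Y = 2 * p₂ * X + 4 * p₄ * X ^ 3 + 6 * p₆ * X ^ 5
        + (2 * q₂ * X + 4 * q₄ * X ^ 3 + 6 * q₆ * X ^ 5) * Real.log X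
        + (0 + q₂ * X ^ 2 + q₄ * X ^ 4 + q₆ * X ^ 6) * X⁻¹ := by
  unfold dR
  rw [show (fun x => U x Y) = _ from funext hU]
  exact (hasDerivAt_PQlog p₀ p₂ p₄ p₆ 0 q₂ q₄ q₆ hX).deriv

/-- Radial part of `Δ*` for `U(·, Y) = P + Q log` (`Q(0) = 0`) at `X > 0`:
`X ∂_X(X⁻¹ ∂_X U) = 2q₂ + (8p₄ + 6q₄)X² + (24p₆ + 10q₆)X⁴ + (8q₄X² + 24q₆X⁴) log X`. [folklore] -/
private theorem radialPart_PQlog {U : ℝ → ℝ → ℝ} {Y p₀ p₂ p₄ p₆ q₂ q₄ q₆ : ℝ}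
    (hU : ∀ x, U x Y = p₀ + p₂ * x ^ 2 + p₄ * x ^ 4 + p₆ * x ^ 6
        + (0 + q₂ * x ^ 2 + q₄ * x ^ 4 + q₆ * x ^ 6) * Real.log x) {X : ℝ} (hX : 0 < X) :
    X * deriv (fun x => x⁻¹ * dR U x Y) X
      = 2 * q₂ + (8 * p₄ + 6 * q₄) * X ^ 2 + (24 * p₆ + 10 * q₆) * X ^ 4
        + (8 * q₄ * X ^ 2 + 24 * q₆ * X ^ 4) * Real.log X := by
  have hfun : (fun x => x⁻¹ * dR U x Y) =ᶠ[nhds X]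
      fun x => (2 * p₂ + q₂) + (4 * p₄ + q₄) * x ^ 2 + (6 * p₆ + q₆) * x ^ 4 + 0 * x ^ 6
        + (2 * q₂ + 4 * q₄ * x ^ 2 + 6 * q₆ * x ^ 4 + 0 * x ^ 6) * Real.log x := by
    filter_upwards [Ioi_mem_nhds hX] with x hx
    rw [Set.mem_Ioi] at hx
    rw [dR_PQlog hU hx]
    field_simp
    ring
  rw [hfun.deriv_eq,
    (hasDerivAt_PQlog (2 * p₂ + q₂) (4 * p₄ + q₄) (6 * p₆ + q₆) 0 (2 * q₂) (4 * q₄) (6 * q₆) 0 hX).deriv]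
  field_simp
  ring

/-- `∂²U/∂Y²` when `y ↦ U(X, y)` is a sextic `g₀ + g₁y + … + g₆y⁶`:
`2g₂ + 6g₃Y + 12g₄Y² + 20g₅Y³ + 30g₆Y⁴`. [folklore] -/
private theorem dZZ_sextic {U : ℝ → ℝ → ℝ} {X g₀ g₁ g₂ g₃ g₄ g₅ g₆ : ℝ}
    (hU : ∀ y, U X y = g₀ + g₁ * y + g₂ * y ^ 2 + g₃ * y ^ 3 + g₄ * y ^ 4 + g₅ * y ^ 5 + g₆ * y ^ 6)
    (Y : ℝ) : dZZ U X Y = 2 * g₂ + 6 * g₃ * Y + 12 * g₄ * Y ^ 2 + 20 * g₅ * Y ^ 3 + 30 * g₆ * Y ^ 4 := by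
  unfold dZZ
  rw [show U X = _ from funext hU, show (2 : ℕ) = 1 + 1 from rfl, iteratedDeriv_succ, iteratedDeriv_one,
    show deriv (fun y => g₀ + g₁ * y + g₂ * y ^ 2 + g₃ * y ^ 3 + g₄ * y ^ 4 + g₅ * y ^ 5 + g₆ * y ^ 6)
        = fun y => g₁ + 2 * g₂ * y + 3 * g₃ * y ^ 2 + 4 * g₄ * y ^ 3 + 5 * g₅ * y ^ 4 + 6 * g₆ * y ^ 5
          + 0 * y ^ 6
      from funext fun y => by rw [(hasDerivAt_sextic g₀ g₁ g₂ g₃ g₄ g₅ g₆ y).deriv]; ring]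
  rw [(hasDerivAt_sextic g₁ (2 * g₂) (3 * g₃) (4 * g₄) (5 * g₅) (6 * g₆) 0 Y).deriv]
  ring

/-- `Δ*U(X,Y)` for `U(·,Y) = P + Q log` (`Q(0) = 0`) and `U(X,·)` a sextic, `X > 0`. [folklore] -/
private theorem gsOperator_PQlog {U : ℝ → ℝ → ℝ} {X Y p₀ p₂ p₄ p₆ q₂ q₄ q₆ g₀ g₁ g₂ g₃ g₄ g₅ g₆ : ℝ}
    (hX : 0 < X)
    (hU : ∀ x, U x Y = p₀ + p₂ * x ^ 2 + p₄ * x ^ 4 + p₆ * x ^ 6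
        + (0 + q₂ * x ^ 2 + q₄ * x ^ 4 + q₆ * x ^ 6) * Real.log x)
    (hV : ∀ y, U X y = g₀ + g₁ * y + g₂ * y ^ 2 + g₃ * y ^ 3 + g₄ * y ^ 4 + g₅ * y ^ 5 + g₆ * y ^ 6) :
    gsOperator U X Y
      = 2 * q₂ + (8 * p₄ + 6 * q₄) * X ^ 2 + (24 * p₆ + 10 * q₆) * X ^ 4
        + (8 * q₄ * X ^ 2 + 24 * q₆ * X ^ 4) * Real.log X
        + (2 * g₂ + 6 * g₃ * Y + 12 * g₄ * Y ^ 2 + 20 * g₅ * Y ^ 3 + 30 * g₆ * Y ^ 4) := by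
  unfold gsOperator
  rw [radialPart_PQlog hU hX, dZZ_sextic hV Y]

/-! ## The printed solutions (6.151), (6.153), (6.161) -/

/-- Particular solution `U_P(X,Y) = (α/2) X² ln X + ((1−α)/8) X⁴`. [cite: Freidberg2014, §6.6.1 eq. (6.151)] -/
def UP (α : ℝ) (X Y : ℝ) : ℝ := α / 2 * X ^ 2 * Real.log X + (1 - α) / 8 * X ^ 4 + 0 * Y

/-- `U₀ = 1`. [cite: Freidberg2014, §6.6.1 eq. (6.153)] -/
def U0 (X Y : ℝ) : ℝ := 1 + 0 * X + 0 * Y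
/-- `U₁ = X²`. [cite: Freidberg2014, §6.6.1 eq. (6.153)] -/
def U1 (X Y : ℝ) : ℝ := X ^ 2 + 0 * Y
/-- `U₂ = Y² − X² ln X`. [cite: Freidberg2014, §6.6.1 eq. (6.153)] -/
def U2 (X Y : ℝ) : ℝ := Y ^ 2 - X ^ 2 * Real.log X
/-- `U₃ = X⁴ − 4X²Y²`. [cite: Freidberg2014, §6.6.1 eq. (6.153)] -/
def U3 (X Y : ℝ) : ℝ := X ^ 4 - 4 * X ^ 2 * Y ^ 2
/-- `U₄ = 2Y⁴ − 9Y²X² − (12Y²X² − 3X⁴) ln X`. [cite: Freidberg2014, §6.6.1 eq. (6.153)] -/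
def U4 (X Y : ℝ) : ℝ := 2 * Y ^ 4 - 9 * Y ^ 2 * X ^ 2 - (12 * Y ^ 2 * X ^ 2 - 3 * X ^ 4) * Real.log X
/-- `U₅ = X⁶ − 12X⁴Y² + 8X²Y⁴`. [cite: Freidberg2014, §6.6.1 eq. (6.153)] -/
def U5 (X Y : ℝ) : ℝ := X ^ 6 - 12 * X ^ 4 * Y ^ 2 + 8 * X ^ 2 * Y ^ 4
/-- `U₆ = 8Y⁶ − 140Y⁴X² + 75Y²X⁴ − (120Y⁴X² − 180Y²X⁴ + 15X⁶) ln X`. [cite: Freidberg2014, §6.6.1 eq. (6.153)] -/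
def U6 (X Y : ℝ) : ℝ :=
  8 * Y ^ 6 - 140 * Y ^ 4 * X ^ 2 + 75 * Y ^ 2 * X ^ 4
    - (120 * Y ^ 4 * X ^ 2 - 180 * Y ^ 2 * X ^ 4 + 15 * X ^ 6) * Real.log X
/-- `U₇ = Y` (odd in `Y`; up–down asymmetric extension). [cite: Freidberg2014, §6.6.5 eq. (6.161)] -/
def U7 (X Y : ℝ) : ℝ := Y + 0 * X
/-- `U₈ = YX²`. [cite: Freidberg2014, §6.6.5 eq. (6.161)] -/
def U8 (X Y : ℝ) : ℝ := Y * X ^ 2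
/-- `U₉ = Y³ − 3YX² ln X`. [cite: Freidberg2014, §6.6.5 eq. (6.161)] -/
def U9 (X Y : ℝ) : ℝ := Y ^ 3 - 3 * Y * X ^ 2 * Real.log X
/-- `U₁₀ = 4Y³X² − 3YX⁴`. [cite: Freidberg2014, §6.6.5 eq. (6.161)] -/
def U10 (X Y : ℝ) : ℝ := 4 * Y ^ 3 * X ^ 2 - 3 * Y * X ^ 4
/-- `U₁₁ = 8Y⁵ − 45YX⁴ − (80Y³X² − 60YX⁴) ln X`. [cite: Freidberg2014, §6.6.5 eq. (6.161)] -/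
def U11 (X Y : ℝ) : ℝ := 8 * Y ^ 5 - 45 * Y * X ^ 4 - (80 * Y ^ 3 * X ^ 2 - 60 * Y * X ^ 4) * Real.log X

/-- The up–down symmetric solution family `U = U_P + Σ_{j=0}^{6} c_j U_j` (written out).
[cite: Freidberg2014, §6.6.1 eq. (6.153)] -/
def cfSolution (α : ℝ) (c : Fin 7 → ℝ) (X Y : ℝ) : ℝ :=
  UP α X Y + c 0 * U0 X Y + c 1 * U1 X Y + c 2 * U2 X Y + c 3 * U3 X Y + c 4 * U4 X Y
    + c 5 * U5 X Y + c 6 * U6 X Y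

/-- The up–down asymmetric (single-null) family `U = U_P + Σ_{j=0}^{11} c_j U_j` (written out).
[cite: Freidberg2014, §6.6.5 eq. (6.160)] -/
def cfSolutionAsym (α : ℝ) (c : Fin 12 → ℝ) (X Y : ℝ) : ℝ :=
  UP α X Y + c 0 * U0 X Y + c 1 * U1 X Y + c 2 * U2 X Y + c 3 * U3 X Y + c 4 * U4 X Y
    + c 5 * U5 X Y + c 6 * U6 X Y + c 7 * U7 X Y + c 8 * U8 X Y + c 9 * U9 X Y
    + c 10 * U10 X Y + c 11 * U11 X Y

/-! ## Direct substitution: every member solves (6.150) on `{X > 0}` -/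

/-- **`Δ* U_P = α + (1 − α) X²`** (`X > 0`). [cite: Freidberg2014, §6.6.1 eq. (6.151)] -/
theorem gsOperator_UP (α : ℝ) {X : ℝ} (Y : ℝ) (hX : 0 < X) :
    gsOperator (UP α) X Y = α + (1 - α) * X ^ 2 := by
  rw [gsOperator_PQlog (U := UP α) (p₀ := 0) (p₂ := 0) (p₄ := (1 - α) / 8) (p₆ := 0) (q₂ := α / 2)
    (q₄ := 0) (q₆ := 0) (g₀ := α / 2 * X ^ 2 * Real.log X + (1 - α) / 8 * X ^ 4) (g₁ := 0) (g₂ := 0)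
    (g₃ := 0) (g₄ := 0) (g₅ := 0) (g₆ := 0) hX (fun x => by unfold UP; ring) (fun y => by unfold UP; ring)]
  ring

/-- **The asymmetric family (6.160) solves the normalised Solov'ev equation (6.150) on `{X > 0}`** for all
`α` and all coefficients `c₀ … c₁₁` («each polynomial solution can be easily found by direct
substitution» — here substituted once and for all). [cite: Freidberg2014, §6.6.5 eq. (6.160)] -/
theorem gsOperator_cfSolutionAsym (α : ℝ) (c : Fin 12 → ℝ) {X : ℝ} (Y : ℝ) (hX : 0 < X) :
    gsOperator (cfSolutionAsym α c) X Y = α + (1 - α) * X ^ 2 := by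
  rw [gsOperator_PQlog (U := cfSolutionAsym α c)
    (p₀ := c 0 + c 2 * Y ^ 2 + c 4 * (2 * Y ^ 4) + c 6 * (8 * Y ^ 6) + c 7 * Y + c 9 * Y ^ 3
      + c 11 * (8 * Y ^ 5))
    (p₂ := c 1 - c 3 * (4 * Y ^ 2) - c 4 * (9 * Y ^ 2) + c 5 * (8 * Y ^ 4) - c 6 * (140 * Y ^ 4)
      + c 8 * Y + c 10 * (4 * Y ^ 3))
    (p₄ := (1 - α) / 8 + c 3 - c 5 * (12 * Y ^ 2) + c 6 * (75 * Y ^ 2) - c 10 * (3 * Y) - c 11 * (45 * Y))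
    (p₆ := c 5)
    (q₂ := α / 2 - c 2 - c 4 * (12 * Y ^ 2) - c 6 * (120 * Y ^ 4) - c 9 * (3 * Y) - c 11 * (80 * Y ^ 3))
    (q₄ := c 4 * 3 + c 6 * (180 * Y ^ 2) + c 11 * (60 * Y)) (q₆ := -(c 6 * 15))
    (g₀ := α / 2 * X ^ 2 * Real.log X + (1 - α) / 8 * X ^ 4 + c 0 + c 1 * X ^ 2
      - c 2 * (X ^ 2 * Real.log X) + c 3 * X ^ 4 + c 4 * (3 * X ^ 4 * Real.log X) + c 5 * X ^ 6
      - c 6 * (15 * X ^ 6 * Real.log X))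
    (g₁ := c 7 + c 8 * X ^ 2 - c 9 * (3 * X ^ 2 * Real.log X) - c 10 * (3 * X ^ 4)
      - c 11 * (45 * X ^ 4) + c 11 * (60 * X ^ 4 * Real.log X))
    (g₂ := c 2 - c 3 * (4 * X ^ 2) - c 4 * (9 * X ^ 2) - c 4 * (12 * X ^ 2 * Real.log X)
      - c 5 * (12 * X ^ 4) + c 6 * (75 * X ^ 4) + c 6 * (180 * X ^ 4 * Real.log X))
    (g₃ := c 9 + c 10 * (4 * X ^ 2) - c 11 * (80 * X ^ 2 * Real.log X))
    (g₄ := c 4 * 2 + c 5 * (8 * X ^ 2) - c 6 * (140 * X ^ 2) - c 6 * (120 * X ^ 2 * Real.log X))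
    (g₅ := c 11 * 8) (g₆ := c 6 * 8) hX
    (fun x => by unfold cfSolutionAsym UP U0 U1 U2 U3 U4 U5 U6 U7 U8 U9 U10 U11; ring)
    (fun y => by unfold cfSolutionAsym UP U0 U1 U2 U3 U4 U5 U6 U7 U8 U9 U10 U11; ring)]
  ring

/-- Hence the asymmetric family is a `GradShafranov.IsNormalisedSolovevSolutionOn {X > 0}`.
[cite: Freidberg2014, §6.6.5 eq. (6.160)] -/
theorem isNormalisedSolovevSolutionOn_cfSolutionAsym (α : ℝ) (c : Fin 12 → ℝ) :
    IsNormalisedSolovevSolutionOn {x : ℝ × ℝ | 0 < x.1} (cfSolutionAsym α c) α :=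
  fun _ Y h => gsOperator_cfSolutionAsym α c Y h

/-- The symmetric family (6.153) is the asymmetric one with `c₇ = … = c₁₁ = 0`.
[cite: Freidberg2014, §6.6.1 eq. (6.153)] -/
theorem cfSolution_eq_asym (α : ℝ) (c : Fin 7 → ℝ) :
    cfSolution α c = cfSolutionAsym α (fun j => if h : (j : ℕ) < 7 then c ⟨j, h⟩ else 0) := by
  funext X Y
  unfold cfSolution cfSolutionAsym
  simp

/-- **The symmetric family (6.153) solves (6.150) on `{X > 0}`.** [cite: Freidberg2014, §6.6.1 eq. (6.153)] -/
theorem isNormalisedSolovevSolutionOn_cfSolution (α : ℝ) (c : Fin 7 → ℝ) :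
    IsNormalisedSolovevSolutionOn {x : ℝ × ℝ | 0 < x.1} (cfSolution α c) α := by
  rw [cfSolution_eq_asym]
  exact isNormalisedSolovevSolutionOn_cfSolutionAsym α _

/-! ## The boundary constraints (6.154)–(6.156), (6.162) and the figures of merit (6.157)–(6.158) -/

/-- The reference («desired») plasma surface `X = 1 + ε cos(τ + δ₀ sin τ)`, `Y = εκ sin τ`, triangularity
`δ = sin δ₀` (matched by a solution only at the constraint points). [cite: Freidberg2014, §6.6.1 eq. (6.154)] -/
def referenceSurface (ε κ δ₀ : ℝ) (τ : ℝ) : ℝ × ℝ := (1 + ε * Real.cos (τ + δ₀ * Real.sin τ), ε * κ * Real.sin τ)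

/-- Curvature coefficient `N₁ = (1 + δ₀)²/(εκ²)` at the outer equatorial point. [cite: Freidberg2014, §6.6.1 eq. (6.156)] -/
def N1 (ε κ δ₀ : ℝ) : ℝ := (1 + δ₀) ^ 2 / (ε * κ ^ 2)
/-- Curvature coefficient `N₂ = −(1 − δ₀)²/(εκ²)` at the inner equatorial point. [cite: Freidberg2014, §6.6.1 eq. (6.156)] -/
def N2 (ε κ δ₀ : ℝ) : ℝ := -((1 - δ₀) ^ 2 / (ε * κ ^ 2))
/-- Curvature coefficient `N₃ = −κ/(ε cos² δ₀)` at the high point. [cite: Freidberg2014, §6.6.1 eq. (6.156)] -/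
def N3 (ε κ δ₀ : ℝ) : ℝ := -(κ / (ε * Real.cos δ₀ ^ 2))

/-- The seven boundary constraints (6.155) on a candidate `U` for shape `(ε, κ, δ₀)` (`δ = sin δ₀`):
flux at the outer/inner equatorial points and the high point, the two equatorial curvature conditions
`U_YY = −N₁U_X`, `U_YY = −N₂U_X`, the high-point slope `U_X = 0` and curvature `U_XX = −N₃U_Y`.
[cite: Freidberg2014, §6.6.1 eq. (6.155)] -/
def IsBoundaryFit (ε κ δ₀ : ℝ) (U : ℝ → ℝ → ℝ) : Prop :=
  U (1 + ε) 0 = 0 ∧ dZZ U (1 + ε) 0 = -(N1 ε κ δ₀ * dR U (1 + ε) 0) ∧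
  U (1 - ε) 0 = 0 ∧ dZZ U (1 - ε) 0 = -(N2 ε κ δ₀ * dR U (1 - ε) 0) ∧
  U (1 - Real.sin δ₀ * ε) (κ * ε) = 0 ∧ dR U (1 - Real.sin δ₀ * ε) (κ * ε) = 0 ∧
  dRR U (1 - Real.sin δ₀ * ε) (κ * ε) = -(N3 ε κ δ₀ * dZ U (1 - Real.sin δ₀ * ε) (κ * ε))

/-- The five additional constraints (6.162) for a single-null configuration with X-point `(X_sep, Y_sep)`:
equatorial slopes `U_Y(1±ε,0) = 0` and `U = U_X = U_Y = 0` at the X-point. [cite: Freidberg2014, §6.6.5 eq. (6.162)] -/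
def IsXPointFit (ε Xsep Ysep : ℝ) (U : ℝ → ℝ → ℝ) : Prop :=
  dZ U (1 + ε) 0 = 0 ∧ dZ U (1 - ε) 0 = 0 ∧ U Xsep Ysep = 0 ∧ dR U Xsep Ysep = 0 ∧ dZ U Xsep Ysep = 0

/-- Area integrals (6.158) over the plasma cross-section `Ω` (in the normalised `(X, Y)` plane):
`K₁ = ∫ [α + (1−α)X²]/X dXdY`. [cite: Freidberg2014, §6.6.1 eq. (6.158)] -/
def K1 (α : ℝ) (Ω : Set (ℝ × ℝ)) : ℝ :=
  ∫ p in Ω, (α + (1 - α) * p.1 ^ 2) / p.1 ∂MeasureTheory.volume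
/-- `K₂ = ∫ X (−U) dXdY`. [cite: Freidberg2014, §6.6.1 eq. (6.158)] -/
def K2 (U : ℝ → ℝ → ℝ) (Ω : Set (ℝ × ℝ)) : ℝ := ∫ p in Ω, p.1 * (-U p.1 p.2) ∂MeasureTheory.volume
/-- `K₃ = ∫ X dXdY`. [cite: Freidberg2014, §6.6.1 eq. (6.158)] -/
def K3 (Ω : Set (ℝ × ℝ)) : ℝ := ∫ p in Ω, p.1 ∂MeasureTheory.volume

/-- `1/q_* = (1/2π)(2/(1+κ²))(ψ₀/(a²B₀)) K₁` — the kink safety factor of a Cerfon–Freidberg equilibrium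
from its normalisation `ψ₀` (returned as `q_*`). [cite: Freidberg2014, §6.6.1 eq. (6.157)] -/
def qStar (κ ψ₀ a B₀ K₁ : ℝ) : ℝ := 1 / ((1 / (2 * π)) * (2 / (1 + κ ^ 2)) * (ψ₀ / (a ^ 2 * B₀)) * K₁)

/-- `β_p = 8π²ε²(1−α)((1+κ²)/2) K₂/(K₁²K₃)`. [cite: Freidberg2014, §6.6.1 eq. (6.157)] -/
def betaP (ε κ α K₁ K₂ K₃ : ℝ) : ℝ :=
  8 * π ^ 2 * ε ^ 2 * (1 - α) * ((1 + κ ^ 2) / 2) * (K₂ / (K₁ ^ 2 * K₃))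

/-- `β_t = [8π²ε⁴(1−α)/q_*²]((1+κ²)/2)² K₂/(K₁²K₃)`. [cite: Freidberg2014, §6.6.1 eq. (6.157)] -/
def betaT (ε κ α qstar K₁ K₂ K₃ : ℝ) : ℝ :=
  8 * π ^ 2 * ε ^ 4 * (1 - α) / qstar ^ 2 * ((1 + κ ^ 2) / 2) ^ 2 * (K₂ / (K₁ ^ 2 * K₃))

/-! ## (append 2026-08-27, gridfusion-model-5 g4) ERRATUM on the signs of `N₁`, `N₂`: the bracket
definitions of (6.156) evaluated on the reference surface (6.154), and the corrected constraint predicate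

Eq. (6.156) as we hold it (galaxy panama:388488381857833 p0150, OCR of the print) reads
`N₁ = [d²X/dY²]_{τ=0} = (1+δ₀)²/(εκ²)`, `N₂ = [d²X/dY²]_{τ=π} = −(1−δ₀)²/(εκ²)`,
`N₃ = [d²Y/dX²]_{τ=π/2} = −κ/(ε cos²δ₀)`, and `N1`, `N2`, `N3` above were typed from the CLOSED FORMS.
Evaluating the BRACKET DEFINITIONS on the curve (6.154) — for a regular parametrisation `(X(τ), Y(τ))`,
`d²X/dY² = (X″Y′ − X′Y″)/Y′³` where `Y′ ≠ 0` and `d²Y/dX² = (Y″X′ − Y′X″)/X′³` where `X′ ≠ 0` — gives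
`[d²X/dY²]_{τ=0} = −(1+δ₀)²/(εκ²) = −N1`, `[d²X/dY²]_{τ=π} = +(1−δ₀)²/(εκ²) = −N2`, `[d²Y/dX²]_{τ=π/2} = N3`
(PROVED below from the derivatives of (6.154): `X′(0) = X′(π) = 0`, `X″(0) = −ε(1+δ₀)²`, `X″(π) = ε(1−δ₀)²`,
`Y′ = εκ cos τ`, `Y″ = −εκ sin τ`, `X′(π/2) = −ε cos δ₀`, `Y′(π/2) = 0`).  So the closed forms printed for
`N₁`, `N₂` carry the OPPOSITE SIGN of the printed bracket definitions (a sign misprint in the text as held,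
or an OCR slip; the primary, Cerfon & Freidberg, Phys. Plasmas 17 (2010) 032502, is not held — acq-11952).
GEOMETRY DECIDES WHICH IS MEANT: a level set `U = 0` osculating the reference surface to second order at the
outer point satisfies `d²/dτ² [U(X(τ), Y(τ))]|_{τ=0} = U_YY·Y′(0)² + U_X·X″(0) = 0` (`X′(0) = 0`, `Y″(0) = 0`),
i.e. `U_YY = −[d²X/dY²]_{τ=0}·U_X`, and likewise at `τ = π` and (with `X ↔ Y`) at `τ = π/2`: the constraints
(6.155) `U_YY = −N₁U_X`, `U_YY = −N₂U_X`, `U_XX = −N₃U_Y` are correct WITH THE BRACKET VALUES.  Numerical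
witness (gridfusion-model-5 g4, kit job j266609, F2-CF-ITER-truth-lineage1.json): for `(ε, κ, δ) =
(8/25, 17/10, 33/100)`, `α = 0`, the seven-coefficient fit with the bracket values leaves `max|U| ≈ 7·10⁻⁷` on
the whole reference surface (`|U_axis| ≈ 3.7·10⁻²`) and a closed level set `U = 0`; with the closed-form
signs `max|U| ≈ 3·10⁻²` and the level set `U = 0` does not close around the axis.  Hence:
`IsBoundaryFitGeom` below = (6.155) with the bracket values, to be used for every instance;
`IsBoundaryFit` (closed-form signs) stays for the record only.  Nothing else in this file depends on the
sign of `N1`, `N2`.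
-/

/-- The graph second derivative `d²X/dY²` of the curve traced by a regular parametrisation `(X(τ), Y(τ))`,
from the parametric derivatives `X′, X″, Y′, Y″` at the point: `(X″Y′ − X′Y″)/Y′³` (`Y′ ≠ 0`; by symmetry
`d²Y/dX² = paramSecondDeriv Y′ Y″ X′ X″` where `X′ ≠ 0`) — the brackets `[d²X/dY²]`, `[d²Y/dX²]` of (6.156).
[cite: Freidberg2014, §6.6.1 eq. (6.156)] -/
def paramSecondDeriv (X1 X2 Y1 Y2 : ℝ) : ℝ := (X2 * Y1 - X1 * Y2) / Y1 ^ 3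

/-- `X(τ) = 1 + ε cos(τ + δ₀ sin τ)` on (6.154). [cite: Freidberg2014, §6.6.1 eq. (6.154)] -/
theorem referenceSurface_fst (ε κ δ₀ τ : ℝ) :
    (referenceSurface ε κ δ₀ τ).1 = 1 + ε * Real.cos (τ + δ₀ * Real.sin τ) := rfl

/-- `Y(τ) = εκ sin τ` on (6.154). [cite: Freidberg2014, §6.6.1 eq. (6.154)] -/
theorem referenceSurface_snd (ε κ δ₀ τ : ℝ) : (referenceSurface ε κ δ₀ τ).2 = ε * κ * Real.sin τ := rfl

/-- `X′(τ) = −ε sin(τ + δ₀ sin τ)(1 + δ₀ cos τ)` along (6.154). [cite: Freidberg2014, §6.6.1 eq. (6.154)] -/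
theorem hasDerivAt_referenceSurface_fst (ε κ δ₀ τ : ℝ) :
    HasDerivAt (fun τ => (referenceSurface ε κ δ₀ τ).1)
      (-(ε * Real.sin (τ + δ₀ * Real.sin τ) * (1 + δ₀ * Real.cos τ))) τ := by
  show HasDerivAt (fun τ => 1 + ε * Real.cos (τ + δ₀ * Real.sin τ)) _ τ
  have h1 : HasDerivAt (fun τ => τ + δ₀ * Real.sin τ) (1 + δ₀ * Real.cos τ) τ :=
    (hasDerivAt_id τ).add ((Real.hasDerivAt_sin τ).const_mul δ₀)
  have h2 := (h1.cos.const_mul ε).const_add 1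
  exact h2.congr_deriv (by ring)

/-- `X″(τ) = −ε[cos(τ + δ₀ sin τ)(1 + δ₀ cos τ)² − sin(τ + δ₀ sin τ)·δ₀ sin τ]` along (6.154).
[cite: Freidberg2014, §6.6.1 eq. (6.154)] -/
theorem hasDerivAt_referenceSurface_fst_deriv (ε δ₀ τ : ℝ) :
    HasDerivAt (fun τ => -(ε * Real.sin (τ + δ₀ * Real.sin τ) * (1 + δ₀ * Real.cos τ)))
      (-(ε * (Real.cos (τ + δ₀ * Real.sin τ) * (1 + δ₀ * Real.cos τ) ^ 2
        - Real.sin (τ + δ₀ * Real.sin τ) * (δ₀ * Real.sin τ)))) τ := by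
  have h1 : HasDerivAt (fun τ => τ + δ₀ * Real.sin τ) (1 + δ₀ * Real.cos τ) τ :=
    (hasDerivAt_id τ).add ((Real.hasDerivAt_sin τ).const_mul δ₀)
  have hc : HasDerivAt (fun τ => 1 + δ₀ * Real.cos τ) (-(δ₀ * Real.sin τ)) τ :=
    (((Real.hasDerivAt_cos τ).const_mul δ₀).const_add 1).congr_deriv (by ring)
  have h : HasDerivAt (fun τ => -(ε * (Real.sin (τ + δ₀ * Real.sin τ) * (1 + δ₀ * Real.cos τ))))
      (-(ε * (Real.cos (τ + δ₀ * Real.sin τ) * (1 + δ₀ * Real.cos τ) * (1 + δ₀ * Real.cos τ)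
        + Real.sin (τ + δ₀ * Real.sin τ) * -(δ₀ * Real.sin τ)))) τ :=
    ((h1.sin.mul hc).const_mul ε).neg
  have e : (fun τ => -(ε * Real.sin (τ + δ₀ * Real.sin τ) * (1 + δ₀ * Real.cos τ)))
      = fun τ => -(ε * (Real.sin (τ + δ₀ * Real.sin τ) * (1 + δ₀ * Real.cos τ))) := by
    funext τ; ring
  rw [e]
  exact h.congr_deriv (by ring)

/-- `Y′(τ) = εκ cos τ` along (6.154). [cite: Freidberg2014, §6.6.1 eq. (6.154)] -/
theorem hasDerivAt_referenceSurface_snd (ε κ δ₀ τ : ℝ) :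
    HasDerivAt (fun τ => (referenceSurface ε κ δ₀ τ).2) (ε * κ * Real.cos τ) τ := by
  show HasDerivAt (fun τ => ε * κ * Real.sin τ) _ τ
  exact (Real.hasDerivAt_sin τ).const_mul (ε * κ)

/-- `Y″(τ) = −εκ sin τ` along (6.154). [cite: Freidberg2014, §6.6.1 eq. (6.154)] -/
theorem hasDerivAt_referenceSurface_snd_deriv (ε κ τ : ℝ) :
    HasDerivAt (fun τ => ε * κ * Real.cos τ) (-(ε * κ * Real.sin τ)) τ :=
  ((Real.hasDerivAt_cos τ).const_mul (ε * κ)).congr_deriv (by ring)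

/-- The parametric derivatives of (6.154) as `deriv`s: `X′`, `X″`, `Y′`, `Y″` at every `τ`.
[cite: Freidberg2014, §6.6.1 eq. (6.154)] -/
theorem deriv_referenceSurface (ε κ δ₀ : ℝ) :
    (deriv (fun τ => (referenceSurface ε κ δ₀ τ).1)
        = fun τ => -(ε * Real.sin (τ + δ₀ * Real.sin τ) * (1 + δ₀ * Real.cos τ))) ∧
    (deriv (deriv fun τ => (referenceSurface ε κ δ₀ τ).1)
        = fun τ => -(ε * (Real.cos (τ + δ₀ * Real.sin τ) * (1 + δ₀ * Real.cos τ) ^ 2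
          - Real.sin (τ + δ₀ * Real.sin τ) * (δ₀ * Real.sin τ)))) ∧
    (deriv (fun τ => (referenceSurface ε κ δ₀ τ).2) = fun τ => ε * κ * Real.cos τ) ∧
    (deriv (deriv fun τ => (referenceSurface ε κ δ₀ τ).2) = fun τ => -(ε * κ * Real.sin τ)) := by
  have hX : deriv (fun τ => (referenceSurface ε κ δ₀ τ).1)
      = fun τ => -(ε * Real.sin (τ + δ₀ * Real.sin τ) * (1 + δ₀ * Real.cos τ)) :=
    funext fun τ => (hasDerivAt_referenceSurface_fst ε κ δ₀ τ).deriv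
  have hY : deriv (fun τ => (referenceSurface ε κ δ₀ τ).2) = fun τ => ε * κ * Real.cos τ :=
    funext fun τ => (hasDerivAt_referenceSurface_snd ε κ δ₀ τ).deriv
  refine ⟨hX, ?_, hY, ?_⟩
  · rw [hX]
    exact funext fun τ => (hasDerivAt_referenceSurface_fst_deriv ε δ₀ τ).deriv
  · rw [hY]
    exact funext fun τ => (hasDerivAt_referenceSurface_snd_deriv ε κ τ).deriv

/-- OUTER EQUATORIAL POINT `τ = 0`: `X′ = 0`, `X″ = −ε(1+δ₀)²`, `Y′ = εκ`, `Y″ = 0`, hence the bracket of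
(6.156) is `[d²X/dY²]_{τ=0} = −(1+δ₀)²/(εκ²) = −N1 ε κ δ₀` — the OPPOSITE sign of the printed closed form
(ERRATUM, see the section docstring). [cite: Freidberg2014, §6.6.1 eq. (6.156)] -/
theorem referenceSurface_bracket_outer {ε κ : ℝ} (hε : ε ≠ 0) (hκ : κ ≠ 0) (δ₀ : ℝ) :
    deriv (fun τ => (referenceSurface ε κ δ₀ τ).1) 0 = 0 ∧
    deriv (deriv fun τ => (referenceSurface ε κ δ₀ τ).1) 0 = -(ε * (1 + δ₀) ^ 2) ∧
    deriv (fun τ => (referenceSurface ε κ δ₀ τ).2) 0 = ε * κ ∧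
    deriv (deriv fun τ => (referenceSurface ε κ δ₀ τ).2) 0 = 0 ∧
    paramSecondDeriv (deriv (fun τ => (referenceSurface ε κ δ₀ τ).1) 0)
        (deriv (deriv fun τ => (referenceSurface ε κ δ₀ τ).1) 0)
        (deriv (fun τ => (referenceSurface ε κ δ₀ τ).2) 0)
        (deriv (deriv fun τ => (referenceSurface ε κ δ₀ τ).2) 0) = -N1 ε κ δ₀ := by
  obtain ⟨h1, h2, h3, h4⟩ := deriv_referenceSurface ε κ δ₀
  have e1 : deriv (fun τ => (referenceSurface ε κ δ₀ τ).1) 0 = 0 := by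
    rw [h1]
    show -(ε * Real.sin (0 + δ₀ * Real.sin 0) * (1 + δ₀ * Real.cos 0)) = 0
    simp only [Real.sin_zero, mul_zero, add_zero, zero_mul, neg_zero]
  have e2 : deriv (deriv fun τ => (referenceSurface ε κ δ₀ τ).1) 0 = -(ε * (1 + δ₀) ^ 2) := by
    rw [h2]
    show -(ε * (Real.cos (0 + δ₀ * Real.sin 0) * (1 + δ₀ * Real.cos 0) ^ 2
      - Real.sin (0 + δ₀ * Real.sin 0) * (δ₀ * Real.sin 0))) = -(ε * (1 + δ₀) ^ 2)
    simp only [Real.sin_zero, Real.cos_zero, mul_zero, add_zero, sub_zero, mul_one, one_mul]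
  have e3 : deriv (fun τ => (referenceSurface ε κ δ₀ τ).2) 0 = ε * κ := by
    rw [h3]
    show ε * κ * Real.cos 0 = ε * κ
    rw [Real.cos_zero, mul_one]
  have e4 : deriv (deriv fun τ => (referenceSurface ε κ δ₀ τ).2) 0 = 0 := by
    rw [h4]
    show -(ε * κ * Real.sin 0) = 0
    rw [Real.sin_zero, mul_zero, neg_zero]
  refine ⟨e1, e2, e3, e4, ?_⟩
  rw [e1, e2, e3, e4]
  unfold paramSecondDeriv N1
  field_simp
  ring

/-- INNER EQUATORIAL POINT `τ = π`: `X′ = 0`, `X″ = ε(1−δ₀)²`, `Y′ = −εκ`, `Y″ = 0`, hence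
`[d²X/dY²]_{τ=π} = +(1−δ₀)²/(εκ²) = −N2 ε κ δ₀` — again the opposite sign of the printed closed form
(ERRATUM). [cite: Freidberg2014, §6.6.1 eq. (6.156)] -/
theorem referenceSurface_bracket_inner {ε κ : ℝ} (hε : ε ≠ 0) (hκ : κ ≠ 0) (δ₀ : ℝ) :
    deriv (fun τ => (referenceSurface ε κ δ₀ τ).1) π = 0 ∧
    deriv (deriv fun τ => (referenceSurface ε κ δ₀ τ).1) π = ε * (1 - δ₀) ^ 2 ∧
    deriv (fun τ => (referenceSurface ε κ δ₀ τ).2) π = -(ε * κ) ∧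
    deriv (deriv fun τ => (referenceSurface ε κ δ₀ τ).2) π = 0 ∧
    paramSecondDeriv (deriv (fun τ => (referenceSurface ε κ δ₀ τ).1) π)
        (deriv (deriv fun τ => (referenceSurface ε κ δ₀ τ).1) π)
        (deriv (fun τ => (referenceSurface ε κ δ₀ τ).2) π)
        (deriv (deriv fun τ => (referenceSurface ε κ δ₀ τ).2) π) = -N2 ε κ δ₀ := by
  obtain ⟨h1, h2, h3, h4⟩ := deriv_referenceSurface ε κ δ₀
  have e1 : deriv (fun τ => (referenceSurface ε κ δ₀ τ).1) π = 0 := by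
    rw [h1]
    show -(ε * Real.sin (π + δ₀ * Real.sin π) * (1 + δ₀ * Real.cos π)) = 0
    simp only [Real.sin_pi, mul_zero, add_zero, zero_mul, neg_zero]
  have e2 : deriv (deriv fun τ => (referenceSurface ε κ δ₀ τ).1) π = ε * (1 - δ₀) ^ 2 := by
    rw [h2]
    show -(ε * (Real.cos (π + δ₀ * Real.sin π) * (1 + δ₀ * Real.cos π) ^ 2
      - Real.sin (π + δ₀ * Real.sin π) * (δ₀ * Real.sin π))) = ε * (1 - δ₀) ^ 2
    simp only [Real.sin_pi, Real.cos_pi, mul_zero, add_zero, sub_zero, mul_neg, mul_one]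
    ring
  have e3 : deriv (fun τ => (referenceSurface ε κ δ₀ τ).2) π = -(ε * κ) := by
    rw [h3]
    show ε * κ * Real.cos π = -(ε * κ)
    rw [Real.cos_pi]
    ring
  have e4 : deriv (deriv fun τ => (referenceSurface ε κ δ₀ τ).2) π = 0 := by
    rw [h4]
    show -(ε * κ * Real.sin π) = 0
    rw [Real.sin_pi, mul_zero, neg_zero]
  refine ⟨e1, e2, e3, e4, ?_⟩
  rw [e1, e2, e3, e4]
  unfold paramSecondDeriv N2
  field_simp
  ring

/-- HIGH POINT `τ = π/2`: `X′ = −ε cos δ₀`, `Y′ = 0`, `Y″ = −εκ`, hence `[d²Y/dX²]_{τ=π/2} =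
(Y″X′ − Y′X″)/X′³ = −κ/(ε cos²δ₀) = N3 ε κ δ₀` — the printed closed form of `N₃` IS the bracket value.
[cite: Freidberg2014, §6.6.1 eq. (6.156)] -/
theorem referenceSurface_bracket_top {ε δ₀ : ℝ} (hε : ε ≠ 0) (hc : Real.cos δ₀ ≠ 0) (κ : ℝ) :
    deriv (fun τ => (referenceSurface ε κ δ₀ τ).1) (π / 2) = -(ε * Real.cos δ₀) ∧
    deriv (fun τ => (referenceSurface ε κ δ₀ τ).2) (π / 2) = 0 ∧
    deriv (deriv fun τ => (referenceSurface ε κ δ₀ τ).2) (π / 2) = -(ε * κ) ∧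
    paramSecondDeriv (deriv (fun τ => (referenceSurface ε κ δ₀ τ).2) (π / 2))
        (deriv (deriv fun τ => (referenceSurface ε κ δ₀ τ).2) (π / 2))
        (deriv (fun τ => (referenceSurface ε κ δ₀ τ).1) (π / 2))
        (deriv (deriv fun τ => (referenceSurface ε κ δ₀ τ).1) (π / 2)) = N3 ε κ δ₀ := by
  obtain ⟨h1, h2, h3, h4⟩ := deriv_referenceSurface ε κ δ₀
  have e1 : deriv (fun τ => (referenceSurface ε κ δ₀ τ).1) (π / 2) = -(ε * Real.cos δ₀) := by
    rw [h1]
    show -(ε * Real.sin (π / 2 + δ₀ * Real.sin (π / 2)) * (1 + δ₀ * Real.cos (π / 2))) = -(ε * Real.cos δ₀)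
    simp only [Real.sin_pi_div_two, Real.cos_pi_div_two, mul_one, mul_zero, add_zero]
    rw [add_comm, Real.sin_add_pi_div_two]
  have e3 : deriv (fun τ => (referenceSurface ε κ δ₀ τ).2) (π / 2) = 0 := by
    rw [h3]
    show ε * κ * Real.cos (π / 2) = 0
    rw [Real.cos_pi_div_two, mul_zero]
  have e4 : deriv (deriv fun τ => (referenceSurface ε κ δ₀ τ).2) (π / 2) = -(ε * κ) := by
    rw [h4]
    show -(ε * κ * Real.sin (π / 2)) = -(ε * κ)
    rw [Real.sin_pi_div_two, mul_one]
  refine ⟨e1, e3, e4, ?_⟩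
  rw [e1, e3, e4]
  unfold paramSecondDeriv N3
  field_simp
  ring

/-- THE SEVEN BOUNDARY CONSTRAINTS (6.155) WITH THE BRACKET VALUES of (6.156) (ERRATUM-CORRECTED; see the
section docstring): flux at the three points, `U_YY = −[d²X/dY²]U_X` at the two equatorial points — i.e.
`U_YY(1+ε,0) = +((1+δ₀)²/(εκ²))U_X = N1·U_X` and `U_YY(1−ε,0) = −((1−δ₀)²/(εκ²))U_X = N2·U_X` in terms of
the typed closed forms — the high-point slope `U_X = 0` and curvature `U_XX = −N₃U_Y`.  This is the
predicate to instance (gridfusion F2 step 2b, Cerfon–Freidberg rows). [cite: Freidberg2014, §6.6.1 eq. (6.155)] -/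
def IsBoundaryFitGeom (ε κ δ₀ : ℝ) (U : ℝ → ℝ → ℝ) : Prop :=
  U (1 + ε) 0 = 0 ∧ dZZ U (1 + ε) 0 = N1 ε κ δ₀ * dR U (1 + ε) 0 ∧
  U (1 - ε) 0 = 0 ∧ dZZ U (1 - ε) 0 = N2 ε κ δ₀ * dR U (1 - ε) 0 ∧
  U (1 - Real.sin δ₀ * ε) (κ * ε) = 0 ∧ dR U (1 - Real.sin δ₀ * ε) (κ * ε) = 0 ∧
  dRR U (1 - Real.sin δ₀ * ε) (κ * ε) = -(N3 ε κ δ₀ * dZ U (1 - Real.sin δ₀ * ε) (κ * ε))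

/-- The corrected predicate differs from `IsBoundaryFit` EXACTLY in the sign of the two equatorial curvature
conditions (constraints 2 and 4); the five others are identical. [cite: Freidberg2014, §6.6.1 eq. (6.155)] -/
theorem isBoundaryFitGeom_iff (ε κ δ₀ : ℝ) (U : ℝ → ℝ → ℝ) :
    IsBoundaryFitGeom ε κ δ₀ U ↔
      (U (1 + ε) 0 = 0 ∧ dZZ U (1 + ε) 0 = -(-N1 ε κ δ₀ * dR U (1 + ε) 0) ∧
       U (1 - ε) 0 = 0 ∧ dZZ U (1 - ε) 0 = -(-N2 ε κ δ₀ * dR U (1 - ε) 0) ∧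
       U (1 - Real.sin δ₀ * ε) (κ * ε) = 0 ∧ dR U (1 - Real.sin δ₀ * ε) (κ * ε) = 0 ∧
       dRR U (1 - Real.sin δ₀ * ε) (κ * ε) = -(N3 ε κ δ₀ * dZ U (1 - Real.sin δ₀ * ε) (κ * ε))) := by
  unfold IsBoundaryFitGeom
  simp only [neg_mul, neg_neg]

end Literature.MathematicalPhysics.MHD.CerfonFreidberg
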